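import Mathlib
import Literature.Computability.Complexity.SymmetricCircuit
import Summits.PneNP.PneNP.Theorems.SymmetryBudgetHamCompilesDefs

/-!
# Keys and ranks of the free classes: comparison and recursion lemmas
# (stub `stub_symmetricA`, line `kotzig-cutspan`, crux `SymmetryBudget.HamCompiles`,
# stmt-PneNP-10637)

Pure combinatorics behind the `Bud(m,g)`-symmetric circuits for the A-side interface `aData`
(file `SymmetryBudgetHamCompilesStubSymmetricA.lean`) and the reusable rank gadget
(`SymmetryBudgetHamCompilesRankGadget.lean`):

* the budget `Bud m (gOf m)` fixes anchored vertices, preserves anchoredness and the comparisons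
  `a < j` with `a` anchored (`bud_apply`, `isAnch_bud_iff`, `lt_bud_iff`);
* membership in a class `cls m x u` unfolded (`mem_cls_iff`);
* the binary-number order on keys: `key N' < key N` iff at the largest index where the indicators
  differ `N` has the `1` (`key_lt_key_iff`), hence `key` is injective (`key_injective`);
* the rank recursion `k + 1 ≤ rk u ↔ ∃ u' free, key (cls u') < key (cls u) ∧ k ≤ rk u'`
  (`succ_le_rk_iff`), which the gadget unrolls into `g` layers of `∨`/`∧` gates.
-/

-- `Summit.PneNP.PneNP.…` duplicates `PneNP` BY DESIGN (single-problem summit, D-0017).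
set_option linter.dupNamespace false

noncomputable section

namespace Summit.PneNP.PneNP.Theorems.HamCompilesKC

open Literature.Computability.Complexity
open Finset

/-! All auxiliary declarations of this stub live in the sub-namespace `SymA` (no clashes with the
sibling stub files of the line, which share the namespace `…HamCompilesKC`). -/
namespace SymA

variable {m : ℕ}

/-! ### Anchored and free vertices under the budget -/

/-- Membership in the free set. -/
theorem mem_freeSet_iff (u : Fin m) : u ∈ freeSet m ↔ ¬ IsAnch m u := by
  simp [freeSet]

/-- Anchored vertices precede free ones. -/
theorem lt_of_isAnch_of_not {a j : Fin m} (ha : IsAnch m a) (hj : ¬ IsAnch m j) : a < j := by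
  unfold IsAnch at ha hj
  rw [Fin.lt_def]
  omega

/-- `g(m) ≤ m`. -/
theorem gOf_le (m : ℕ) : gOf m ≤ m := Nat.log_le_self 2 m

/-- A budget permutation fixes the anchored vertices. -/
theorem bud_apply {ρ : Equiv.Perm (Fin m)} (hρ : ρ ∈ Bud m (gOf m)) {u : Fin m}
    (hu : IsAnch m u) : ρ u = u :=
  (mem_pointStabiliserBudget_iff ρ).1 hρ u hu

/-- A budget permutation preserves anchoredness. -/
theorem isAnch_bud_iff {ρ : Equiv.Perm (Fin m)} (hρ : ρ ∈ Bud m (gOf m)) (u : Fin m) :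
    IsAnch m (ρ u) ↔ IsAnch m u := by
  constructor
  · intro h
    have h1 : ρ (ρ u) = ρ u := bud_apply hρ h
    rwa [ρ.injective h1] at h
  · intro h
    rwa [bud_apply hρ h]

/-- A budget permutation preserves the comparisons with an anchored vertex. -/
theorem lt_bud_iff {ρ : Equiv.Perm (Fin m)} (hρ : ρ ∈ Bud m (gOf m)) {a : Fin m}
    (ha : IsAnch m a) (j : Fin m) : a < ρ j ↔ a < j := by
  by_cases hj : IsAnch m j
  · rw [bud_apply hρ hj]
  · have hj' : ¬ IsAnch m (ρ j) := by rwa [isAnch_bud_iff hρ]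
    exact iff_of_true (lt_of_isAnch_of_not ha hj') (lt_of_isAnch_of_not ha hj)

/-- The guard of the comparator gates is budget-invariant. -/
theorem guard_bud_iff {ρ : Equiv.Perm (Fin m)} (hρ : ρ ∈ Bud m (gOf m)) (a j : Fin m) :
    (IsAnch m (ρ a) ∧ ρ a < ρ j) ↔ (IsAnch m a ∧ a < j) := by
  rw [isAnch_bud_iff hρ]
  refine ⟨fun ⟨ha, hlt⟩ => ⟨ha, ?_⟩, fun ⟨ha, hlt⟩ => ⟨ha, ?_⟩⟩
  · rwa [bud_apply hρ ha, lt_bud_iff hρ ha] at hlt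
  · rwa [bud_apply hρ ha, lt_bud_iff hρ ha]

/-! ### Classes -/

/-- Adjacency in the route's graph. -/
theorem gr_adj_iff (x : Fin m × Fin m → Bool) (u v : Fin m) :
    (Gr m x).Adj u v ↔ u ≠ v ∧ (x (u, v) = true ∨ x (v, u) = true) := by
  simp [Gr, SimpleGraph.fromRel_adj]

/-- Membership in the class of a vertex: an anchored vertex, distinct, adjacent. -/
theorem mem_cls_iff (x : Fin m × Fin m → Bool) (u a : Fin m) :
    a ∈ cls m x u ↔ IsAnch m a ∧ u ≠ a ∧ (x (u, a) = true ∨ x (a, u) = true) := by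
  rw [cls, nbA, mem_filter, mem_compl, mem_freeSet_iff, not_not, gr_adj_iff]

/-- Members of a class are anchored. -/
theorem isAnch_of_mem_cls {x : Fin m × Fin m → Bool} {u a : Fin m} (h : a ∈ cls m x u) :
    IsAnch m a :=
  ((mem_cls_iff x u a).1 h).1

/-! ### The binary-number order on keys -/

/-- `∑_{i<a} 2^i < 2^a`. -/
theorem sum_range_two_pow_lt (a : ℕ) : ∑ i ∈ range a, 2 ^ i < 2 ^ a := by
  induction a with
  | zero => simp
  | succ a ih => rw [sum_range_succ, pow_succ]; omega

/-- `∑_{b<a} 2^b < 2^a` over `Fin m`. -/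
theorem sum_two_pow_lt (a : Fin m) :
    ∑ b ∈ univ.filter (fun b : Fin m => b < a), 2 ^ (b : ℕ) < 2 ^ (a : ℕ) := by
  calc ∑ b ∈ univ.filter (fun b : Fin m => b < a), 2 ^ (b : ℕ)
      = ∑ i ∈ (univ.filter (fun b : Fin m => b < a)).map Fin.valEmbedding, 2 ^ i := by
        rw [sum_map]; rfl
    _ ≤ ∑ i ∈ range a, 2 ^ i := by
        apply sum_le_sum_of_subset
        intro i hi
        rw [mem_map] at hi
        obtain ⟨b, hb, rfl⟩ := hi
        rw [mem_filter] at hb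
        exact mem_range.2 hb.2
    _ < 2 ^ (a : ℕ) := sum_range_two_pow_lt a

/-- **Sufficiency of the comparator.** If `a ∈ N ∖ N'` and the indicators of `N`, `N'` agree
above `a`, then `key N' < key N`. -/
theorem key_lt_key_of_witness {N N' : Finset (Fin m)} {a : Fin m} (ha : a ∈ N) (ha' : a ∉ N')
    (h : ∀ a', a < a' → (a' ∈ N ↔ a' ∈ N')) : key m N' < key m N := by
  unfold key
  have hsplit : ∀ S : Finset (Fin m), ∑ b ∈ S, 2 ^ (b : ℕ) =
      ∑ b ∈ S.filter (fun b => a < b), 2 ^ (b : ℕ) +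
        ∑ b ∈ S.filter (fun b => ¬ a < b), 2 ^ (b : ℕ) :=
    fun S => (sum_filter_add_sum_filter_not S (fun b => a < b) _).symm
  have htop : N.filter (fun b => a < b) = N'.filter (fun b => a < b) := by
    ext b
    simp only [mem_filter]
    constructor
    · rintro ⟨hb, hab⟩; exact ⟨(h b hab).1 hb, hab⟩
    · rintro ⟨hb, hab⟩; exact ⟨(h b hab).2 hb, hab⟩
  have hlow' : ∑ b ∈ N'.filter (fun b => ¬ a < b), 2 ^ (b : ℕ) < 2 ^ (a : ℕ) := by
    refine lt_of_le_of_lt (sum_le_sum_of_subset ?_) (sum_two_pow_lt a)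
    intro b hb
    rw [mem_filter] at hb ⊢
    refine ⟨mem_univ _, lt_of_le_of_ne (not_lt.1 hb.2) ?_⟩
    rintro rfl
    exact ha' hb.1
  have hlow : 2 ^ (a : ℕ) ≤ ∑ b ∈ N.filter (fun b => ¬ a < b), 2 ^ (b : ℕ) :=
    single_le_sum (f := fun b : Fin m => 2 ^ (b : ℕ)) (fun _ _ => Nat.zero_le _)
      (mem_filter.2 ⟨ha, lt_irrefl a⟩)
  rw [hsplit N, hsplit N', htop]
  omega

/-- Two distinct index sets differ at a largest index, above which they agree. -/
theorem exists_top_diff {N N' : Finset (Fin m)} (hNN : N ≠ N') :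
    ∃ a, (a ∈ N ∧ a ∉ N' ∨ a ∈ N' ∧ a ∉ N) ∧
      ∀ a', a < a' → (a' ∈ N ↔ a' ∈ N') := by
  have hne : (symmDiff N N').Nonempty := by
    rw [nonempty_iff_ne_empty, Ne, ← bot_eq_empty, symmDiff_eq_bot]
    exact hNN
  refine ⟨(symmDiff N N').max' hne, ?_, fun a' hlt' => ?_⟩
  · have hamem : (symmDiff N N').max' hne ∈ symmDiff N N' := max'_mem _ _
    rwa [mem_symmDiff] at hamem
  · by_contra hcon
    have hmem : a' ∈ symmDiff N N' := by rw [mem_symmDiff]; tauto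
    exact absurd (le_max' _ _ hmem) (not_le.2 hlt')

/-- **The comparator.** `key N' < key N` iff at the largest index where the indicators differ,
`N` has the `1`. -/
theorem key_lt_key_iff (N N' : Finset (Fin m)) :
    key m N' < key m N ↔
      ∃ a, a ∈ N ∧ a ∉ N' ∧ ∀ a', a < a' → (a' ∈ N ↔ a' ∈ N') := by
  refine ⟨fun hlt => ?_, fun ⟨a, ha, ha', h⟩ => key_lt_key_of_witness ha ha' h⟩
  have hNN : N ≠ N' := by rintro rfl; exact lt_irrefl _ hlt
  obtain ⟨a, hdiff, habove⟩ := exists_top_diff hNN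
  rcases hdiff with ⟨haN, haN'⟩ | ⟨haN', haN⟩
  · exact ⟨a, haN, haN', habove⟩
  · exact absurd hlt (lt_asymm
      (key_lt_key_of_witness haN' haN (fun a' h => (habove a' h).symm)))

/-- Keys are binary numbers: `key` is injective. -/
theorem key_injective : Function.Injective (key m) := by
  intro N N' h
  by_contra hNN
  obtain ⟨a, hdiff, habove⟩ := exists_top_diff hNN
  rcases hdiff with ⟨haN, haN'⟩ | ⟨haN', haN⟩
  · exact absurd h (key_lt_key_of_witness haN haN' habove).ne'
  · exact absurd h (key_lt_key_of_witness haN' haN (fun a' h => (habove a' h).symm)).ne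

/-! ### The rank recursion -/

/-- **The rank recursion.** A vertex has at least `k + 1` classes below it iff some free vertex
with a smaller key has at least `k` classes below it (take a vertex of the largest class below;
conversely add that class). -/
theorem succ_le_rk_iff (x : Fin m × Fin m → Bool) (u : Fin m) (k : ℕ) :
    k + 1 ≤ rk m x u ↔
      ∃ u' ∈ freeSet m, key m (cls m x u') < key m (cls m x u) ∧ k ≤ rk m x u' := by
  set D : Fin m → Finset (Finset (Fin m)) :=
    fun v => (classes m x).filter fun N' => key m N' < key m (cls m x v) with hD
  have hrk : ∀ v, rk m x v = (D v).card := fun v => rfl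
  have hmemD : ∀ v N', N' ∈ D v ↔ N' ∈ classes m x ∧ key m N' < key m (cls m x v) :=
    fun v N' => by rw [hD, mem_filter]
  simp only [hrk]
  constructor
  · intro hk
    have hne : (D u).Nonempty := by rw [← card_pos]; omega
    obtain ⟨N', hN'D, hmax⟩ := exists_max_image (D u) (key m) hne
    obtain ⟨hN'cl, hlt⟩ := (hmemD u N').1 hN'D
    obtain ⟨u', hu'F, rfl⟩ := mem_image.1 hN'cl
    refine ⟨u', hu'F, hlt, ?_⟩
    have hsub : (D u).erase (cls m x u') ⊆ D u' := by
      intro N'' hN''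
      obtain ⟨hne', hN''D⟩ := mem_erase.1 hN''
      have hle := hmax N'' hN''D
      rw [hmemD] at hN''D ⊢
      exact ⟨hN''D.1, lt_of_le_of_ne hle fun heq => hne' (key_injective heq)⟩
    have := card_le_card hsub
    rw [card_erase_of_mem hN'D] at this
    omega
  · rintro ⟨u', hu'F, hlt, hk⟩
    have hnot : cls m x u' ∉ D u' := fun h => lt_irrefl _ ((hmemD u' _).1 h).2
    have hsub : insert (cls m x u') (D u') ⊆ D u := by
      intro N'' hN''
      rw [hmemD]
      rcases mem_insert.1 hN'' with rfl | hN''D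
      · exact ⟨mem_image_of_mem _ hu'F, hlt⟩
      · obtain ⟨hcl, hlt'⟩ := (hmemD u' N'').1 hN''D
        exact ⟨hcl, hlt'.trans hlt⟩
    have := card_le_card hsub
    rw [card_insert_of_notMem hnot] at this
    omega

end SymA

end Summit.PneNP.PneNP.Theorems.HamCompilesKC
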